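import Mathlib.Analysis.SpecialFunctions.Pow.Deriv
import Mathlib.Analysis.SpecialFunctions.Pow.Continuity
import Mathlib.Analysis.SpecialFunctions.Integrability.Basic
import Mathlib.MeasureTheory.Integral.IntervalIntegral.FundThmCalculus
import Mathlib.MeasureTheory.Integral.DominatedConvergence
import HarnessLib

/-!
# The `β`-sieve delay-differential system: forward construction of solutions

Trunk `AntSieve`; companion to `Literature.NumberTheory.Sieve.SieveFunctions` (item
`provefact Literature.exists_isBetaSieveData`). Everything in this file is proved; no number theory is
involved.

For a dimension `κ`, a parameter `β ≥ 1` and a constant `A`, the Rosser–Iwaniec system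
(Iwaniec, *Rosser's sieve*, Acta Arith. 36 (1980), (1.7)–(1.9); Greaves, *Sieves in Number Theory*,
(4.2.1.1)–(4.2.1.3) with `C = A`, `B = 0`)

* `s^κ F(s) = A` for `0 < s ≤ β + 1`, `f(s) = 0` for `0 < s ≤ β`,
* `(s^κ F(s))' = κ s^{κ−1} f(s − 1)` for `s > β + 1`, `(s^κ f(s))' = κ s^{κ−1} F(s − 1)` for `s > β`,

has, WITHOUT any normalisation at infinity, exactly one pair of continuous solutions `F, f` on
`(0, ∞)`, obtained by integrating forward one unit interval at a time ("method of steps"). In the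
combinations `P = F + f`, `Q = F − f` of Greaves (4.2.1.8) the system decouples:
`(s^κ P)' = κ s^{κ−1} P(s−1)`, `(s^κ Q)' = −κ s^{κ−1} Q(s−1)` for `s > β` with
`s^κ P = s^κ Q = A` on `(0, β]` (Greaves (4.2.1.9), (4.2.1.11)–(4.2.1.12)), i.e. `w = s^κ P` and
`w = s^κ Q` solve the scalar delay equation `w'(s) = c k_κ(s) w(s − 1)` (`c = ±1`) with the kernel
`k_κ(s) = κ s^{κ−1} (s − 1)^{−κ}` and constant history `w = A` on `(−∞, β]`.

## Contents (all proved)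

* `delaySeq`, `delaySol β c A k` — the forward solution of
  `w' = c k(s) w(s − 1)`, `w = A` on `(−∞, β]`, for an arbitrary kernel `k`; the integral equation
  `delaySol_eq_integral`, continuity `continuous_delaySol` and the delay equation
  `hasDerivAt_delaySol` (for `k` continuous on `(β, ∞)` and integrable on `(β, β + 1)`).
* `sieveKernel κ` — `k_κ`; its integrability on `(β, β + 1)` for `β > 1`, and for `β = 1`
  when `κ < 1` (`intervalIntegrable_sieveKernel`).
* `fwdUpper κ β A`, `fwdLower κ β A` — the pair `(F, f)`; the theorem
  `fwd_spec` collects: `F(s) = A s^{−κ}` on `(0, β + 1]`, `f = 0` on `(0, β]`, the two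
  delay-differential equations (the `F`-equation even for all `s > β`), continuity on `(0, ∞)`,
  and the explicit form of `P, Q` (`fwdUpper ± fwdLower = s^{−κ} · delaySol β (±1) A k_κ`).

The normalisation `F, f = 1 + O(e^{−s})` (which forces `q_κ(β − 1) = 0` and the value of `A`;
necessity is `IsBetaSieveSolution.adjoint_apply_eq_zero` of `SieveAdjoint.lean`) is not asserted
here; it is the subject of the existence theorem built on this file.

## Relation to `BetaSieveForward.lean` (refactor note)

`Literature/NumberTheory/Sieve/BetaSieveForward.lean` (namespace `Literature.BetaSieveForward`:
`step`, `iter`, `upper`, `lower`, `isForwardSolution`; landed while this file was in review)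
constructs the same forward solution for `β > 1`, with the same field-by-field specification as
`fwd_spec`. The present file is a strict generalisation — it also covers `β = 1` with `κ < 1`,
which the existence theorem needs for `κ = 1/2` (`β_{1/2} = 1`), by decoupling the system into the
scalar delay equations for `s^κ (F ± f)` — and is meant to SUPERSEDE it: for `β > 1`,
`BetaSieveForward.upper κ β A = fwdUpper κ β A` and `BetaSieveForward.lower κ β A = fwdLower κ β A`
on `(0, ∞)` by the method-of-steps uniqueness `IsBetaSieveSolution.eqOn_zero_step` of
`SieveFunctions.lean` (not formalised here; nothing imports `BetaSieveForward.lean` at present).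
Refactor: retire `BetaSieveForward.lean`'s `step/iter/upper/lower` in favour of
`fwdUpper/fwdLower`, or merge this file into it. To ease the merge, the declarations below live in
the same namespace `Literature.BetaSieveForward` and avoid its names (`continuousOn_delayIntegrand` rather
than `continuousOn_integrand`, etc.); `Literature.BetaSieve` is not used because it is the namespace of
the combinatorial Rosser truncation sets of `SieveFrameworkFundamentalLemma.lean`.

## References

* H. Iwaniec, *Rosser's sieve*, Acta Arith. 36 (1980), 171–202, (1.7)–(1.9).
* G. Greaves, *Sieves in Number Theory*, Springer 2001, §4.2.1, (4.2.1.1)–(4.2.1.13).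
-/

open Filter Set MeasureTheory intervalIntegral

noncomputable section

namespace Literature.NumberTheory.Sieve

namespace BetaSieveForward

/-! ### Forward solution of the scalar delay equation `w'(s) = c k(s) w(s − 1)` -/

section Delay

variable (β c A : ℝ) (k : ℝ → ℝ)

/-- Picard steps for the delay equation `w'(s) = c k(s) w(s − 1)` with history `w = A` on
`(−∞, β]`: `delaySeq 0 = A` and `delaySeq (n+1) (s) = A + c ∫_β^{max β s} k(t) · delaySeq n (t − 1) dt`.
The `n`-th step is the solution on `(−∞, β + n]` ("method of steps"). [folklore] -/
def delaySeq : ℕ → ℝ → ℝ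
  | 0 => fun _ => A
  | n + 1 => fun s => A + c * ∫ t in β..max β s, k t * delaySeq n (t - 1)

/-- The forward solution `w` of `w'(s) = c k(s) w(s − 1)` (`s > β`), `w = A` on `(−∞, β]`, obtained
by the method of steps: at `s` it is the Picard step of any level `n ≥ s − β`. [folklore] -/
def delaySol (s : ℝ) : ℝ := delaySeq β c A k (⌊s - β⌋₊ + 1) s

variable {β c A k}

/-- Step `0` is the constant history `A`. [folklore] -/
theorem delaySeq_zero (s : ℝ) : delaySeq β c A k 0 s = A := rfl

/-- The defining recursion of the Picard steps. [folklore] -/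
theorem delaySeq_succ (n : ℕ) (s : ℝ) :
    delaySeq β c A k (n + 1) s = A + c * ∫ t in β..max β s, k t * delaySeq β c A k n (t - 1) :=
  rfl

/-- Every Picard step equals the history `A` on `(−∞, β]`. [folklore] -/
theorem delaySeq_of_le (n : ℕ) {s : ℝ} (hs : s ≤ β) : delaySeq β c A k n s = A := by
  cases n with
  | zero => rfl
  | succ n =>
    rw [delaySeq_succ, max_eq_left hs, intervalIntegral.integral_same, mul_zero, add_zero]

/-- Stabilisation of the Picard steps: step `n + 1` agrees with step `n` on `(−∞, β + n]`.
[folklore] -/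
theorem delaySeq_succ_eq :
    ∀ (n : ℕ) {s : ℝ}, s ≤ β + n → delaySeq β c A k (n + 1) s = delaySeq β c A k n s := by
  intro n
  induction n with
  | zero =>
    intro s hs
    simp only [Nat.cast_zero, add_zero] at hs
    rw [delaySeq_of_le _ hs, delaySeq_of_le _ hs]
  | succ m ih =>
    intro s hs
    rw [delaySeq_succ, delaySeq_succ]
    congr 2
    refine intervalIntegral.integral_congr fun t ht => ?_
    rw [uIcc_of_le (le_max_left β s)] at ht
    show k t * delaySeq β c A k (m + 1) (t - 1) = k t * delaySeq β c A k m (t - 1)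
    rw [ih]
    push_cast at hs
    rcases le_total β s with h | h
    · rw [max_eq_right h] at ht; linarith [ht.2]
    · rw [max_eq_left h] at ht; linarith [ht.2, m.cast_nonneg (α := ℝ)]

/-- Stabilisation, iterated. [folklore] -/
theorem delaySeq_eq_of_le {n m : ℕ} (hnm : n ≤ m) {s : ℝ} (hs : s ≤ β + n) :
    delaySeq β c A k m s = delaySeq β c A k n s := by
  induction m, hnm using Nat.le_induction with
  | base => rfl
  | succ m hm ih =>
    rw [← ih]
    apply delaySeq_succ_eq
    have : (n : ℝ) ≤ m := by exact_mod_cast hm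
    linarith

/-- `s ≤ β + (⌊s − β⌋ + 1)`: the level used in `delaySol` reaches `s`. [folklore] -/
theorem le_add_floor_add_one (s : ℝ) : s ≤ β + ((⌊s - β⌋₊ + 1 : ℕ) : ℝ) := by
  have := Nat.lt_floor_add_one (s - β)
  push_cast
  linarith

/-- The forward solution at `s` is the Picard step of any level `n ≥ s − β`. [folklore] -/
theorem delaySol_eq {n : ℕ} {s : ℝ} (hs : s ≤ β + n) :
    delaySol β c A k s = delaySeq β c A k n s := by
  unfold delaySol
  have hN := le_add_floor_add_one (β := β) s
  rcases le_total n (⌊s - β⌋₊ + 1) with h | h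
  · exact delaySeq_eq_of_le h hs
  · exact (delaySeq_eq_of_le h hN).symm

/-- The forward solution equals the history `A` on `(−∞, β]`. [folklore] -/
theorem delaySol_of_le {s : ℝ} (hs : s ≤ β) : delaySol β c A k s = A :=
  delaySeq_of_le _ hs

/-- **The integral equation** `w(s) = A + c ∫_β^{max β s} k(t) w(t − 1) dt` for all `s`.
[folklore] -/
theorem delaySol_eq_integral (s : ℝ) :
    delaySol β c A k s = A + c * ∫ t in β..max β s, k t * delaySol β c A k (t - 1) := by
  set n : ℕ := ⌊s - β⌋₊ with hn
  have hs : s ≤ β + ((n + 1 : ℕ) : ℝ) := le_add_floor_add_one s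
  rw [delaySol_eq hs, delaySeq_succ]
  congr 2
  refine intervalIntegral.integral_congr fun t ht => ?_
  rw [uIcc_of_le (le_max_left β s)] at ht
  show k t * delaySeq β c A k n (t - 1) = k t * delaySol β c A k (t - 1)
  rw [delaySol_eq (n := n)]
  push_cast at hs
  rcases le_total β s with h | h
  · rw [max_eq_right h] at ht; linarith [ht.2]
  · rw [max_eq_left h] at ht; linarith [ht.2, n.cast_nonneg (α := ℝ)]

/-- The integral equation for `s ≥ β`. [folklore] -/
theorem delaySol_eq_integral_of_le {s : ℝ} (hs : β ≤ s) :
    delaySol β c A k s = A + c * ∫ t in β..s, k t * delaySol β c A k (t - 1) := by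
  rw [delaySol_eq_integral, max_eq_right hs]

/-- On `[β, β + 1]` the integrand only sees the history: `k(t) w(t − 1) = k(t) A`. [folklore] -/
theorem delayIntegrand_eq_of_le {t : ℝ} (ht : t ≤ β + 1) :
    k t * delaySol β c A k (t - 1) = k t * A := by
  rw [delaySol_of_le (by linarith)]

/-- On `[β, β + 1]`: `w(s) = A + c A ∫_β^s k`. [folklore] -/
theorem delaySol_eq_of_mem_Icc {s : ℝ} (hs : s ∈ Icc β (β + 1)) :
    delaySol β c A k s = A + c * (A * ∫ t in β..s, k t) := by
  rw [delaySol_eq_integral_of_le hs.1]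
  congr 2
  rw [← intervalIntegral.integral_const_mul]
  refine intervalIntegral.integral_congr fun t ht => ?_
  rw [uIcc_of_le hs.1] at ht
  show k t * delaySol β c A k (t - 1) = A * k t
  rw [delayIntegrand_eq_of_le (by linarith [ht.2, hs.2]), mul_comm]

/-! #### Continuity and the delay equation -/

/-- Continuity of the forward solution on `(−∞, β + n]` together with integrability of the
integrand on `[β, β + n]`, by induction on `n` (the kernel being continuous on `(β, ∞)` and
integrable on `(β, β + 1)`). [folklore] -/
theorem continuousOn_delaySol_aux (hk : ContinuousOn k (Ioi β))
    (hk' : IntervalIntegrable k volume β (β + 1)) (n : ℕ) :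
    ContinuousOn (delaySol β c A k) (Iic (β + n)) ∧
      IntervalIntegrable (fun t => k t * delaySol β c A k (t - 1)) volume β (β + n) := by
  induction n with
  | zero =>
    simp only [Nat.cast_zero, add_zero]
    refine ⟨continuousOn_const.congr fun s hs => delaySol_of_le hs, IntervalIntegrable.refl⟩
  | succ n ih =>
    obtain ⟨hc, -⟩ := ih
    -- integrability on `[β, β + n + 1]`
    have hi1 : IntervalIntegrable (fun t => k t * delaySol β c A k (t - 1)) volume β (β + 1) := by
      refine (hk'.mul_const A).congr fun t ht => ?_
      rw [uIoc_of_le (by linarith)] at ht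
      exact (delayIntegrand_eq_of_le ht.2).symm
    have hi2 : IntervalIntegrable (fun t => k t * delaySol β c A k (t - 1)) volume (β + 1)
        (β + (n + 1 : ℕ)) := by
      refine ContinuousOn.intervalIntegrable ?_
      have hsub : uIcc (β + 1) (β + (n + 1 : ℕ)) = Icc (β + 1) (β + (n + 1 : ℕ)) :=
        uIcc_of_le (by push_cast; linarith [n.cast_nonneg (α := ℝ)])
      rw [hsub]
      refine (hk.mono fun t ht => ?_).mul (hc.comp (continuousOn_id.sub continuousOn_const) ?_)
      · simp only [mem_Ioi]; linarith [ht.1]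
      · intro t ht
        simp only [mem_Iic]
        push_cast at ht ⊢
        linarith [ht.2]
    have hi : IntervalIntegrable (fun t => k t * delaySol β c A k (t - 1)) volume β
        (β + (n + 1 : ℕ)) := hi1.trans hi2
    refine ⟨?_, hi⟩
    -- continuity on `(−∞, β + n + 1]` from the integral equation
    have hprim : ContinuousOn (fun u => ∫ t in β..u, k t * delaySol β c A k (t - 1))
        (Icc β (β + (n + 1 : ℕ))) := by
      have := intervalIntegral.continuousOn_primitive_interval' hi left_mem_uIcc
      rwa [uIcc_of_le (by push_cast; linarith [n.cast_nonneg (α := ℝ)])] at this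
    have hmax : ContinuousOn (fun s => max β s) (Iic (β + (n + 1 : ℕ))) :=
      (continuous_const.max continuous_id).continuousOn
    have hmaps : MapsTo (fun s => max β s) (Iic (β + (n + 1 : ℕ))) (Icc β (β + (n + 1 : ℕ))) :=
      fun s hs => ⟨le_max_left _ _, max_le (by push_cast; linarith [n.cast_nonneg (α := ℝ)]) hs⟩
    have hcomp := hprim.comp hmax hmaps
    have hfull : ContinuousOn
        (fun s => A + c * ∫ t in β..max β s, k t * delaySol β c A k (t - 1))
        (Iic (β + (n + 1 : ℕ))) :=
      continuousOn_const.add (continuousOn_const.mul hcomp)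
    exact hfull.congr fun s _ => delaySol_eq_integral s

/-- **The forward solution is continuous** (on all of `ℝ`). [folklore] -/
theorem continuous_delaySol (hk : ContinuousOn k (Ioi β))
    (hk' : IntervalIntegrable k volume β (β + 1)) : Continuous (delaySol β c A k) := by
  rw [continuous_iff_continuousAt]
  intro s
  obtain ⟨n, hn⟩ := exists_nat_gt (s - β)
  have hs : s < β + n := by linarith
  exact ((continuousOn_delaySol_aux hk hk' n).1.continuousWithinAt (mem_Iic.mpr hs.le)).continuousAt
    (Iic_mem_nhds hs)

/-- The integrand `t ↦ k(t) w(t − 1)` is integrable on every `[a, b] ⊂ [β, ∞)`. [folklore] -/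
theorem intervalIntegrable_delayIntegrand (hk : ContinuousOn k (Ioi β))
    (hk' : IntervalIntegrable k volume β (β + 1)) {a b : ℝ} (ha : β ≤ a) (hb : β ≤ b) :
    IntervalIntegrable (fun t => k t * delaySol β c A k (t - 1)) volume a b := by
  obtain ⟨n, hn⟩ := exists_nat_gt (max a b - β)
  have h := (continuousOn_delaySol_aux (c := c) (A := A) hk hk' n).2
  refine h.mono_set ?_
  rw [uIcc_of_le (by linarith [le_max_left a b] : β ≤ β + n)]
  intro t ht
  rcases le_total a b with hab | hab
  · rw [uIcc_of_le hab] at ht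
    exact ⟨ha.trans ht.1, by linarith [ht.2, le_max_right a b]⟩
  · rw [uIcc_of_ge hab] at ht
    exact ⟨hb.trans ht.1, by linarith [ht.2, le_max_left a b]⟩

/-- The integrand is continuous on `(β, ∞)`. [folklore] -/
theorem continuousOn_delayIntegrand (hk : ContinuousOn k (Ioi β))
    (hk' : IntervalIntegrable k volume β (β + 1)) :
    ContinuousOn (fun t => k t * delaySol β c A k (t - 1)) (Ioi β) :=
  hk.mul ((continuous_delaySol hk hk').comp (continuous_id.sub continuous_const)).continuousOn

/-- **The delay equation**: for `s > β`, `w'(s) = c k(s) w(s − 1)`. [folklore] -/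
theorem hasDerivAt_delaySol (hk : ContinuousOn k (Ioi β))
    (hk' : IntervalIntegrable k volume β (β + 1)) {s : ℝ} (hs : β < s) :
    HasDerivAt (delaySol β c A k) (c * (k s * delaySol β c A k (s - 1))) s := by
  have heq : (fun u => A + c * ∫ t in β..u, k t * delaySol β c A k (t - 1)) =ᶠ[nhds s]
      delaySol β c A k := by
    filter_upwards [Ioi_mem_nhds hs] with u hu
    rw [delaySol_eq_integral_of_le (le_of_lt hu)]
  have hg := continuousOn_delayIntegrand (c := c) (A := A) hk hk'
  have h1 : HasDerivAt (fun u => ∫ t in β..u, k t * delaySol β c A k (t - 1))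
      (k s * delaySol β c A k (s - 1)) s :=
    intervalIntegral.integral_hasDerivAt_right (intervalIntegrable_delayIntegrand hk hk' le_rfl hs.le)
      (hg.stronglyMeasurableAtFilter isOpen_Ioi s hs) (hg.continuousAt (Ioi_mem_nhds hs))
  exact ((h1.const_mul c).const_add A).congr_of_eventuallyEq heq.symm

/-- With a nonnegative kernel and `c = 1`, `A ≥ 0`: `w ≥ A` on `[β, β + 1]`. [folklore] -/
theorem le_delaySol_one_of_mem_Icc (hk0 : ∀ t ∈ Icc β (β + 1), 0 ≤ k t) (hA : 0 ≤ A) {s : ℝ}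
    (hs : s ∈ Icc β (β + 1)) : A ≤ delaySol β 1 A k s := by
  rw [delaySol_eq_of_mem_Icc hs, one_mul]
  have hint : 0 ≤ ∫ t in β..s, k t :=
    intervalIntegral.integral_nonneg hs.1 fun t ht => hk0 t ⟨ht.1, ht.2.trans hs.2⟩
  nlinarith

end Delay

/-! ### The sieve kernel `k_κ(s) = κ s^{κ−1} (s − 1)^{−κ}` -/

/-- The kernel `k_κ(s) = κ s^{κ−1} (s − 1)^{−κ}` of the decoupled equations
`(s^κ P)' = κ s^{κ−1} (s−1)^{−κ} · ((s−1)^κ P(s−1))` (Greaves, *Sieves in Number Theory*,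
(4.2.1.9), (4.2.1.5): `dx^κ/(x−1)^κ`). [cite: Greaves2001, (4.2.1.5)] -/
def sieveKernel (κ : ℝ) (s : ℝ) : ℝ := κ * s ^ (κ - 1) * (s - 1) ^ (-κ)

/-- `k_κ` is continuous on `(1, ∞)`. [folklore] -/
theorem continuousOn_sieveKernel (κ : ℝ) : ContinuousOn (sieveKernel κ) (Ioi 1) := by
  refine ContinuousOn.mul (continuousOn_const.mul ?_) ?_
  · exact continuousOn_id.rpow_const fun _ hs => Or.inl (ne_of_gt (lt_trans one_pos hs))
  · exact (continuousOn_id.sub continuousOn_const).rpow_const fun s hs =>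
      Or.inl (sub_ne_zero.mpr (ne_of_gt (show (1 : ℝ) < s from hs)))

/-- `k_κ` is continuous on `(β, ∞)` for `β ≥ 1`. [folklore] -/
theorem continuousOn_sieveKernel_of_le (κ : ℝ) {β : ℝ} (hβ : 1 ≤ β) :
    ContinuousOn (sieveKernel κ) (Ioi β) :=
  (continuousOn_sieveKernel κ).mono fun _ hs => lt_of_le_of_lt hβ hs

/-- `k_κ(s) ≥ 0` for `s ≥ 1`, `κ ≥ 0`. [folklore] -/
theorem sieveKernel_nonneg {κ : ℝ} (hκ : 0 ≤ κ) {s : ℝ} (hs : 1 ≤ s) : 0 ≤ sieveKernel κ s :=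
  mul_nonneg (mul_nonneg hκ (Real.rpow_nonneg (by linarith) _)) (Real.rpow_nonneg (by linarith) _)

/-- `k_κ(s) > 0` for `s > 1`, `κ > 0`. [folklore] -/
theorem sieveKernel_pos {κ : ℝ} (hκ : 0 < κ) {s : ℝ} (hs : 1 < s) : 0 < sieveKernel κ s :=
  mul_pos (mul_pos hκ (Real.rpow_pos_of_pos (by linarith) _)) (Real.rpow_pos_of_pos (by linarith) _)

/-- **Integrability of the kernel on `(β, β + 1)`**: automatic for `β > 1`; for `β = 1` it is the
condition `κ < 1` (convergence of `∫_1 dx^κ/(x − 1)^κ`, Greaves (4.2.1.5); this is why `β = 1`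
is admissible only for `κ < 1`, in particular for `κ = 1/2`). [cite: Greaves2001, (4.2.1.5)] -/
theorem intervalIntegrable_sieveKernel {κ β : ℝ} (hβ : 1 ≤ β) (h : β = 1 → κ < 1) :
    IntervalIntegrable (sieveKernel κ) volume β (β + 1) := by
  rcases eq_or_lt_of_le hβ with h1 | h1
  · -- `β = 1`, `κ < 1`
    have hκ := h h1.symm
    subst h1
    have hr : IntervalIntegrable (fun x : ℝ => x ^ (-κ)) volume 0 1 :=
      intervalIntegral.intervalIntegrable_rpow' (by linarith)
    have hr' : IntervalIntegrable (fun x : ℝ => (x - 1) ^ (-κ)) volume 1 2 := by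
      have := hr.comp_sub_right 1
      norm_num at this
      exact this
    have hc : ContinuousOn (fun s : ℝ => κ * s ^ (κ - 1)) (uIcc 1 2) := by
      refine continuousOn_const.mul (continuousOn_of_forall_continuousAt fun s hs => ?_)
      rw [uIcc_of_le (by norm_num)] at hs
      exact Real.continuousAt_rpow_const s (κ - 1) (Or.inl (by linarith [hs.1]))
    have := hr'.continuousOn_mul hc
    norm_num at this ⊢
    exact this
  · refine ContinuousOn.intervalIntegrable ?_
    rw [uIcc_of_le (by linarith)]
    exact (continuousOn_sieveKernel κ).mono fun s hs => lt_of_lt_of_le h1 hs.1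

/-! ### The forward solution pair `(F, f)` -/

section Fwd

variable (κ β A : ℝ)

/-- `s^κ P(s)` for the forward solution: `delaySol β 1 A k_κ` (Greaves (4.2.1.9), `P = F + f`).
[cite: Greaves2001, (4.2.1.9)] -/
def fwdP : ℝ → ℝ := delaySol β 1 A (sieveKernel κ)

/-- `s^κ Q(s)` for the forward solution: `delaySol β (−1) A k_κ` (Greaves (4.2.1.9), `Q = F − f`).
[cite: Greaves2001, (4.2.1.9)] -/
def fwdQ : ℝ → ℝ := delaySol β (-1) A (sieveKernel κ)

/-- **The forward upper function** `F(s) = s^{−κ} (s^κ P + s^κ Q)/2` of the `β`-sieve system with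
parameter `β` and constant `A` (no normalisation at infinity). [cite: Greaves2001, (4.2.1.8)] -/
def fwdUpper (s : ℝ) : ℝ := s ^ (-κ) * ((fwdP κ β A s + fwdQ κ β A s) / 2)

/-- **The forward lower function** `f(s) = s^{−κ} (s^κ P − s^κ Q)/2`. [cite: Greaves2001, (4.2.1.8)] -/
def fwdLower (s : ℝ) : ℝ := s ^ (-κ) * ((fwdP κ β A s - fwdQ κ β A s) / 2)

variable {κ β A}

/-- `F + f = s^{−κ} · (s^κ P)` (Greaves (4.2.1.8), `P = F + f`). [cite: Greaves2001, (4.2.1.8)] -/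
theorem fwdUpper_add_fwdLower (s : ℝ) :
    fwdUpper κ β A s + fwdLower κ β A s = s ^ (-κ) * fwdP κ β A s := by
  simp only [fwdUpper, fwdLower]; ring

/-- `F − f = s^{−κ} · (s^κ Q)` (Greaves (4.2.1.8), `Q = F − f`). [cite: Greaves2001, (4.2.1.8)] -/
theorem fwdUpper_sub_fwdLower (s : ℝ) :
    fwdUpper κ β A s - fwdLower κ β A s = s ^ (-κ) * fwdQ κ β A s := by
  simp only [fwdUpper, fwdLower]; ring

/-- `s^κ P(s) = A` for `s ≤ β` (constant history). [folklore] -/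
theorem fwdP_of_le {s : ℝ} (hs : s ≤ β) : fwdP κ β A s = A := delaySol_of_le hs

/-- `s^κ Q(s) = A` for `s ≤ β` (constant history). [folklore] -/
theorem fwdQ_of_le {s : ℝ} (hs : s ≤ β) : fwdQ κ β A s = A := delaySol_of_le hs

/-- On `[β, β + 1]`: `s^κ P = A (1 + ∫_β^s k_κ)`, `s^κ Q = A (1 − ∫_β^s k_κ)` (Greaves (4.2.1.11)
with `B = 0`). [cite: Greaves2001, (4.2.1.11)] -/
theorem fwdP_eq_of_mem_Icc {s : ℝ} (hs : s ∈ Icc β (β + 1)) :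
    fwdP κ β A s = A + A * ∫ t in β..s, sieveKernel κ t := by
  rw [fwdP, delaySol_eq_of_mem_Icc hs, one_mul]

/-- On `[β, β + 1]`: `s^κ Q = A (1 − ∫_β^s k_κ)` (Greaves (4.2.1.11) with `B = 0`). [cite: Greaves2001, (4.2.1.11)] -/
theorem fwdQ_eq_of_mem_Icc {s : ℝ} (hs : s ∈ Icc β (β + 1)) :
    fwdQ κ β A s = A - A * ∫ t in β..s, sieveKernel κ t := by
  rw [fwdQ, delaySol_eq_of_mem_Icc hs]; ring

/-- `s^κ F(s) = (s^κ P + s^κ Q)/2 = A` on `(−∞, β + 1]`. [folklore] -/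
theorem fwdP_add_fwdQ_of_le {s : ℝ} (hs : s ≤ β + 1) :
    (fwdP κ β A s + fwdQ κ β A s) / 2 = A := by
  rcases le_total s β with h | h
  · rw [fwdP_of_le h, fwdQ_of_le h]; ring
  · rw [fwdP_eq_of_mem_Icc ⟨h, hs⟩, fwdQ_eq_of_mem_Icc ⟨h, hs⟩]; ring

/-- **Initial condition for `F`**: `F(s) = A s^{−κ}` for `s ≤ β + 1`. [cite: Greaves2001, (4.2.1.3)] -/
theorem fwdUpper_eq_of_le {s : ℝ} (hs : s ≤ β + 1) : fwdUpper κ β A s = A * s ^ (-κ) := by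
  rw [fwdUpper, fwdP_add_fwdQ_of_le hs, mul_comm]

/-- **Initial condition for `f`**: `f(s) = 0` for `s ≤ β`. [cite: Greaves2001, (4.2.1.3)] -/
theorem fwdLower_eq_of_le {s : ℝ} (hs : s ≤ β) : fwdLower κ β A s = 0 := by
  rw [fwdLower, fwdP_of_le hs, fwdQ_of_le hs, sub_self, zero_div, mul_zero]

/-- `s ↦ s^{−κ}` is continuous on `(0, ∞)`. [folklore] -/
theorem continuousOn_rpow_neg (κ : ℝ) : ContinuousOn (fun s : ℝ => s ^ (-κ)) (Ioi 0) :=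
  continuousOn_id.rpow_const fun _ hs => Or.inl (ne_of_gt hs)

section Analysis

variable (hβ : 1 ≤ β) (hκβ : β = 1 → κ < 1)
include hβ hκβ

/-- `s^κ P` (the forward solution) is continuous. [folklore] -/
theorem continuous_fwdP : Continuous (fwdP κ β A) :=
  continuous_delaySol (continuousOn_sieveKernel_of_le κ hβ) (intervalIntegrable_sieveKernel hβ hκβ)

/-- `s^κ Q` (the forward solution) is continuous. [folklore] -/
theorem continuous_fwdQ : Continuous (fwdQ κ β A) :=
  continuous_delaySol (continuousOn_sieveKernel_of_le κ hβ) (intervalIntegrable_sieveKernel hβ hκβ)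

/-- `(s^κ P)'(s) = k_κ(s) · (s−1)^κ P(s−1)`-form: `fwdP' (s) = k_κ(s) fwdP(s − 1)` for `s > β`.
Greaves prints (4.2.1.9) for `s ≥ β + 1`; the range `β < s ≤ β + 1` proved here rests on `B = 0`
and the convention `f = 0` on `(0, β]` (constant history `s^κ P = A` on `(−∞, β]`), for which both
sides of (4.2.1.1) vanish there. [cite: Greaves2001, (4.2.1.9)] -/
theorem hasDerivAt_fwdP {s : ℝ} (hs : β < s) :
    HasDerivAt (fwdP κ β A) (sieveKernel κ s * fwdP κ β A (s - 1)) s := by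
  have := hasDerivAt_delaySol (c := 1) (A := A) (continuousOn_sieveKernel_of_le κ hβ)
    (intervalIntegrable_sieveKernel hβ hκβ) hs
  rwa [one_mul] at this

/-- `fwdQ'(s) = −k_κ(s) fwdQ(s − 1)` for `s > β` (printed for `s ≥ β + 1`; the extension to
`(β, β + 1]` rests on `B = 0` and `f = 0` on `(0, β]`, as for `hasDerivAt_fwdP`).
[cite: Greaves2001, (4.2.1.9)] -/
theorem hasDerivAt_fwdQ {s : ℝ} (hs : β < s) :
    HasDerivAt (fwdQ κ β A) (-(sieveKernel κ s * fwdQ κ β A (s - 1))) s := by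
  have := hasDerivAt_delaySol (c := -1) (A := A) (continuousOn_sieveKernel_of_le κ hβ)
    (intervalIntegrable_sieveKernel hβ hκβ) hs
  rwa [neg_one_mul] at this

/-- `F` is continuous on `(0, ∞)`. [folklore] -/
theorem continuousOn_fwdUpper : ContinuousOn (fwdUpper κ β A) (Ioi 0) :=
  (continuousOn_rpow_neg κ).mul
    (((continuous_fwdP hβ hκβ).add (continuous_fwdQ hβ hκβ)).div_const 2).continuousOn

/-- `f` is continuous on `(0, ∞)`. [folklore] -/
theorem continuousOn_fwdLower : ContinuousOn (fwdLower κ β A) (Ioi 0) :=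
  (continuousOn_rpow_neg κ).mul
    (((continuous_fwdP hβ hκβ).sub (continuous_fwdQ hβ hκβ)).div_const 2).continuousOn

omit hβ hκβ in
/-- `t^κ · (t^{−κ} u) = u` near `s > 0`. [folklore] -/
theorem rpow_mul_rpow_neg_mul_eventuallyEq (u : ℝ → ℝ) {s : ℝ} (hs : 0 < s) :
    (fun t : ℝ => t ^ κ * (t ^ (-κ) * u t)) =ᶠ[nhds s] u := by
  filter_upwards [Ioi_mem_nhds hs] with t ht
  rw [← mul_assoc, Real.rpow_neg (le_of_lt ht), mul_inv_cancel₀ (Real.rpow_pos_of_pos ht κ).ne',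
    one_mul]

omit hβ hκβ in
/-- Algebra of the kernel: `k_κ(s) · X = κ s^{κ−1} · ((s−1)^{−κ} X)`. [folklore] -/
theorem sieveKernel_mul (s X : ℝ) :
    sieveKernel κ s * X = κ * s ^ (κ - 1) * ((s - 1) ^ (-κ) * X) := by
  simp only [sieveKernel]; ring

/-- **The `F`-equation** `(s^κ F(s))' = κ s^{κ−1} f(s − 1)`, here for all `s > β` (on `(β, β + 1]`
both sides vanish). [cite: Greaves2001, (4.2.1.1)] -/
theorem hasDerivAt_rpow_mul_fwdUpper {s : ℝ} (hs : β < s) :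
    HasDerivAt (fun t : ℝ => t ^ κ * fwdUpper κ β A t)
      (κ * s ^ (κ - 1) * fwdLower κ β A (s - 1)) s := by
  have hs0 : 0 < s := by linarith
  have hu : HasDerivAt (fun t => (fwdP κ β A t + fwdQ κ β A t) / 2)
      ((sieveKernel κ s * fwdP κ β A (s - 1) + -(sieveKernel κ s * fwdQ κ β A (s - 1))) / 2) s :=
    ((hasDerivAt_fwdP hβ hκβ hs).add (hasDerivAt_fwdQ hβ hκβ hs)).div_const 2
  have heq : (fun t : ℝ => t ^ κ * fwdUpper κ β A t) =ᶠ[nhds s]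
      fun t => (fwdP κ β A t + fwdQ κ β A t) / 2 :=
    rpow_mul_rpow_neg_mul_eventuallyEq (κ := κ) (fun t => (fwdP κ β A t + fwdQ κ β A t) / 2) hs0
  refine (hu.congr_of_eventuallyEq heq).congr_deriv ?_
  rw [fwdLower, show (sieveKernel κ s * fwdP κ β A (s - 1) + -(sieveKernel κ s * fwdQ κ β A (s - 1)))
    / 2 = sieveKernel κ s * ((fwdP κ β A (s - 1) - fwdQ κ β A (s - 1)) / 2) by ring, sieveKernel_mul]

/-- **The `f`-equation** `(s^κ f(s))' = κ s^{κ−1} F(s − 1)` for `s > β`. [cite: Greaves2001, (4.2.1.2)] -/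
theorem hasDerivAt_rpow_mul_fwdLower {s : ℝ} (hs : β < s) :
    HasDerivAt (fun t : ℝ => t ^ κ * fwdLower κ β A t)
      (κ * s ^ (κ - 1) * fwdUpper κ β A (s - 1)) s := by
  have hs0 : 0 < s := by linarith
  have hu : HasDerivAt (fun t => (fwdP κ β A t - fwdQ κ β A t) / 2)
      ((sieveKernel κ s * fwdP κ β A (s - 1) - -(sieveKernel κ s * fwdQ κ β A (s - 1))) / 2) s :=
    ((hasDerivAt_fwdP hβ hκβ hs).sub (hasDerivAt_fwdQ hβ hκβ hs)).div_const 2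
  have heq : (fun t : ℝ => t ^ κ * fwdLower κ β A t) =ᶠ[nhds s]
      fun t => (fwdP κ β A t - fwdQ κ β A t) / 2 :=
    rpow_mul_rpow_neg_mul_eventuallyEq (κ := κ) (fun t => (fwdP κ β A t - fwdQ κ β A t) / 2) hs0
  refine (hu.congr_of_eventuallyEq heq).congr_deriv ?_
  rw [fwdUpper, show (sieveKernel κ s * fwdP κ β A (s - 1) - -(sieveKernel κ s * fwdQ κ β A (s - 1)))
    / 2 = sieveKernel κ s * ((fwdP κ β A (s - 1) + fwdQ κ β A (s - 1)) / 2) by ring, sieveKernel_mul]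

/-- **The forward solution of the `β`-sieve system** (method of steps): for `β ≥ 1` (and `κ < 1`
if `β = 1`) and any constant `A`, the pair `(F, f) = (fwdUpper κ β A, fwdLower κ β A)` satisfies
`F(s) = A s^{−κ}` on `(0, β + 1]`, `f = 0` on `(0, β]`, the delay-differential equations
`(s^κ F)' = κ s^{κ−1} f(s−1)` (`s > β + 1`, indeed `s > β`) and `(s^κ f)' = κ s^{κ−1} F(s−1)`
(`s > β`), and `F, f` are continuous on `(0, ∞)` (Greaves, *Sieves in Number Theory*,
(4.2.1.1)–(4.2.1.3) with `C = A`, `B = 0`; Iwaniec 1980, (1.7)–(1.9)). No normalisation at infinity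
is asserted. [cite: Greaves2001, (4.2.1.1)–(4.2.1.3)] -/
theorem fwd_spec :
    (∀ s ∈ Ioc 0 (β + 1), fwdUpper κ β A s = A * s ^ (-κ)) ∧
    (∀ s ∈ Ioc 0 β, fwdLower κ β A s = 0) ∧
    (∀ s : ℝ, β + 1 < s → HasDerivAt (fun t : ℝ => t ^ κ * fwdUpper κ β A t)
      (κ * s ^ (κ - 1) * fwdLower κ β A (s - 1)) s) ∧
    (∀ s : ℝ, β < s → HasDerivAt (fun t : ℝ => t ^ κ * fwdLower κ β A t)
      (κ * s ^ (κ - 1) * fwdUpper κ β A (s - 1)) s) ∧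
    ContinuousOn (fwdUpper κ β A) (Ioi 0) ∧ ContinuousOn (fwdLower κ β A) (Ioi 0) :=
  ⟨fun _ hs => fwdUpper_eq_of_le hs.2, fun _ hs => fwdLower_eq_of_le hs.2,
    fun _ hs => hasDerivAt_rpow_mul_fwdUpper hβ hκβ (by linarith),
    fun _ hs => hasDerivAt_rpow_mul_fwdLower hβ hκβ hs,
    continuousOn_fwdUpper hβ hκβ, continuousOn_fwdLower hβ hκβ⟩

end Analysis

/-! #### Linearity in `A` and positivity of `P` -/

/-- The Picard steps are linear in the constant `A`. [folklore] -/
theorem delaySeq_smul (β c A : ℝ) (k : ℝ → ℝ) :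
    ∀ (n : ℕ) (s : ℝ), delaySeq β c A k n s = A * delaySeq β c 1 k n s := by
  intro n
  induction n with
  | zero => intro s; simp [delaySeq_zero]
  | succ n ih =>
    intro s
    rw [delaySeq_succ, delaySeq_succ]
    have h : ∫ t in β..max β s, k t * delaySeq β c A k n (t - 1) =
        A * ∫ t in β..max β s, k t * delaySeq β c 1 k n (t - 1) := by
      rw [← intervalIntegral.integral_const_mul]
      refine intervalIntegral.integral_congr fun t _ => ?_
      show k t * delaySeq β c A k n (t - 1) = A * (k t * delaySeq β c 1 k n (t - 1))
      rw [ih]; ring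
    rw [h]; ring

/-- The forward solution is linear in the constant `A`. [folklore] -/
theorem delaySol_smul (β c A : ℝ) (k : ℝ → ℝ) (s : ℝ) :
    delaySol β c A k s = A * delaySol β c 1 k s :=
  delaySeq_smul β c A k _ s

/-- The forward upper function is linear in `A`. [folklore] -/
theorem fwdUpper_smul (κ β A s : ℝ) : fwdUpper κ β A s = A * fwdUpper κ β 1 s := by
  simp only [fwdUpper, fwdP, fwdQ, delaySol_smul β 1 A, delaySol_smul β (-1) A]; ring

/-- The forward lower function is linear in `A`. [folklore] -/
theorem fwdLower_smul (κ β A s : ℝ) : fwdLower κ β A s = A * fwdLower κ β 1 s := by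
  simp only [fwdLower, fwdP, fwdQ, delaySol_smul β 1 A, delaySol_smul β (-1) A]; ring

/-- `s^κ P(s) ≥ A` on `[β, β + 1]` for `A ≥ 0`, `κ ≥ 0` (the kernel is nonnegative).
[folklore] -/
theorem le_fwdP_of_mem_Icc (hβ : 1 ≤ β) (hκ : 0 ≤ κ) (hA : 0 ≤ A)
    {s : ℝ} (hs : s ∈ Icc β (β + 1)) : A ≤ fwdP κ β A s :=
  le_delaySol_one_of_mem_Icc (fun _ ht => sieveKernel_nonneg hκ (hβ.trans ht.1)) hA hs

end Fwd

end BetaSieveForward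

end Literature.NumberTheory.Sieve
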